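import Summits.QuantumFields.YangMills.Theorems.BalabanUVNodesN12FlatDatumRigidityNestedLam
import Summits.QuantumFields.YangMills.Theorems.BalabanUVNodesN12Thm1EUAtFlatDatumAllIndices
import HarnessLib

/-!
# BalabanUVNodes ∕ N12 — PRINT's DATUM `lamBondsSeq` ([II] (2.3)) AT EVERY SEPARATED (2.18) INDEX: the tower-site constraint graph of `Λ_j` is CONNECTED and flat fibre configurations
# with trivial transporters on `Λ_j`'s bonds are RIGID — this seat's `…TowerSiteGraphConnectedNestedLam` §3 ∕ `…FlatDatumRigidityNestedLam` §2 read at `Ω := s.Ω` for every separated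
# cube-class index `s : Seq D k` and every separated index of record `s : Node00.SeqOfRecord F ν M g K k` ((N) from r11's `Chain21`, (B)(S) from the lane's `…Thm1EUAtFlatDatumAllIndices` §1)

[Balaban1984PropagatorsII] = «[II]», (2.3) p. 224 (`Λ_j` as the DIFFERENCE of the bond sets; ruling (α)); [Balaban1988Convergent] = «[III]», (2.1) p. 254, (2.2) p. 255, (2.10)–(2.13)
pp. 256–257, (2.18) p. 257; [Balaban1985RegularSpaces] = «[6]», (1.3)–(1.6) p. 77; [Balaban1985Variational] = «[15]», Thm 1 p. 279, (3)–(4), (7) p. 278.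

Cell `pub-ymgap` (HUMAN RULINGS D-0062 ∕ D-0149), WIDTH SEAT `pub-ymgap-dag-n12-w6` g24 (node N12 = [B15]; key K1⁹ `stmt-QuantumFields-27364`, `--kind proof --supports … --as helper`;
count-neutral).  THEOREMS ONLY (0 `def`, 0 `instance`, 0 `sorry`); `exact`s BY NAME: this seat's ✓p767987 `towerSite_mem_of_closed_lamBondsSeq` and ✓p768460
`exists_gauge_eq_one_on_towers_of_flat_segments_lamBondsSeq` ∕ `exists_towerCentral_gauge_of_flat_segments_lamBondsSeq` (every (N)(B)(S) sequence), fed by r11's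
`Chain21.Ω_succ_subset_Ω` ((N)), the lane's (dag-n12-c g30) `…N12Thm1EUAtFlatDatumAllIndices.isBlockUnion_seq` ∕ `pow_dvd_side` ∕ `pow_dvd_dCubeSide` ((B): cube classes with side a
multiple of `Lʲ`) ∕ `sep_of_seqSeparated` ((S) from NODE 00's `Sect2.SeqSeparated M₁ s`, `1 ≤ M₁`), and this seat's g17 `…Thm1RowAtFlatDatum.letterBudget_atRecord` (the letter budget
`(d+3)Lᵏ ≤ |T_η|` from `k + 1 ≤ m + K` on the family's torus).  Imports: the two green `…Lam` files + `…Thm1EUAtFlatDatumAllIndices` (seam-cone but NOT in the campaign's red set —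
`red_after_d4.json` ∕ `red_v3.txt` both negative; filed before the seam edit).

WHY.  The (E∕U) name at PRINT's datum (dag-n12-c g34 ✓p767125 `B11Thm1ExistsUniqueTokensGB.VariationalThm1EUSepTop7MGB F N Sup Adm bd Dat B₃ a₀ a₁` at `bd := Node00.lamDatum F`,
`lamDatum F K k Ω = lamBondsSeq Ω k` by `rfl`) quantifies EVERY separated index of record `s : SeqOfRecord F ν M g K k` (`0 < k`, `Sect2.SeqSeparated ν.M₁ s`, `0 < ν.M₁`) and
carries [15] Thm 1's tower-central uniqueness clause over `bd K k s.Ω n`.  dag-n12-w1's twist obstruction refutes such a clause at the flat datum from disconnection data of the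
tower-site graph; the two generic `…Lam` files say the data cannot be supplied and flat configurations are rigid for every (N)(B)(S) sequence.  THIS FILE reads both at the indices the
name quantifies — the print-datum twin of this seat's g22 `…TowerSiteGraphConnectedNestedOfRecord` (✓p744890) plus the rigidity the lane's pre-staged A2 witness at `lamDatum` calls
(its (b)-datum edition ✓p744645 :135 calls the `genSet` rigidity at exactly these binders).

CONTENTS (namespace `Summit.QuantumFields.YangMills.BalabanUVNodes.N12FlatDatumRigidityNestedLamOfRecord`): §1 (every separated cube-class index `s : Seq D k`, `D j ⊆ unionsOfCubes (σ j)`,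
`Lʲ ∣ σ j`): ★★ `towerSite_mem_of_closed_lamBondsSeq_of_seq` ∕ ★★ `exists_towerCentral_gauge_of_flat_segments_lamBondsSeq_of_seq`; §2 (every separated index of RECORD): ★★★
`towerSite_mem_of_closed_lamBondsSeq_of_seqSeparated` ∕ ★★ `not_disconnected_towerSiteGraph_lamBondsSeq_of_seqSeparated` ∕ ★★★ `exists_gauge_eq_one_on_towers_of_flat_segments_lamBondsSeq_of_seqSeparated`
∕ ★★★ `exists_towerCentral_gauge_of_flat_segments_lamBondsSeq_of_seqSeparated`; §3 (the torus class of the letters, `D n = unionsOfCubes (side L M₁ n)`): ★★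
`exists_towerCentral_gauge_of_flat_segments_lamBondsSeq_torusClass`.

HONEST FRAMING.  Located PRECONDITIONS (graph connectivity, flat rigidity) of the print-datum uniqueness clause, read at every separated index — NOT [15] Thm 1 at general data, NOT an
(E∕U) producer, NOT the A2 witness (the `IsMinimizerB`-clause at `W := M˙(1)` is the lane's pen); nothing of Bałaban's estimates asserted or refuted; count-neutral helper; N12 NOT
discharged; K0⁷∕K1⁹ NOT closed; counts of record unmoved; one finite 𝕋⁴ programme at fixed ε — R4 closes the conditional rung `BalabanLadder.UV` only; the Yang–Mills mass gap (Clay)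
is NOT proved by any of this; nothing continuum ∕ ℝ⁴ ∕ OS.
-/

namespace Summit.QuantumFields.YangMills.BalabanUVNodes.N12FlatDatumRigidityNestedLamOfRecord

open Set
open Literature.MathematicalPhysics.QuantumFieldTheory.Balaban1983to89
open Literature.MathematicalPhysics.QuantumFieldTheory.Balaban1983to89.Node00
open B15DeterminingSets (DetSet pts mem_pts bondsOf embIter genSet)
open B15DeterminingSetsB (lamBondsSeq)
open B14.Eq22Determines (IsBlockUnion)
open B14.Eq213MaximalDomains (side)
open B16Sect1Backgrounds (toMS)
open T4Continuum (T4Family walk walkEnd holAt netDisp Letter)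
open GaugeField (gaugeAct)
open Summit.QuantumFields.YangMills.BalabanUVNodes.N12TowerSiteGraphConnectedNestedLam (towerSite_mem_of_closed_lamBondsSeq)
open Summit.QuantumFields.YangMills.BalabanUVNodes.N12FlatDatumRigidityNestedLam (exists_gauge_eq_one_on_towers_of_flat_segments_lamBondsSeq
  exists_towerCentral_gauge_of_flat_segments_lamBondsSeq)
open Summit.QuantumFields.YangMills.BalabanUVNodes.N12Thm1EUAtFlatDatumAllIndices (isBlockUnion_seq sep_of_seqSeparated pow_dvd_side pow_dvd_dCubeSide)
open Summit.QuantumFields.YangMills.BalabanUVNodes.N12Thm1RowAtFlatDatum (letterBudget_atRecord)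

/-! ## §1  Every separated (2.18) index over a class of unions of aligned cubes -/

section CubeClass

variable {P : Params}

/-- ★★ **CONNECTIVITY OF THE PRINT-DATUM TOWER-SITE GRAPH, EVERY SEPARATED CUBE-CLASS INDEX**: classes `D j` of unions of cubes of side `σ j` with `Lʲ ∣ σ j` ((B)), an index `s : Seq D k`
(r11's chain ⇒ (N)), `1 ≤ k ≤ m + K`, NODE 00's separation for some `M₁ ≥ 1` ((S)): a set `T` of fine sites closed under the bonds of `lamBondsSeq s.Ω k` holding ONE print tower site
holds them all. [cite: Balaban1984PropagatorsII, (2.3) p.224; Balaban1988Convergent, (2.1) p.254, (2.2) p.255, (2.18) p.257; Balaban1985RegularSpaces, (1.3)–(1.6) p.77; Balaban1985Variational, Thm 1 p.279] -/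
theorem towerSite_mem_of_closed_lamBondsSeq_of_seq {D : ℕ → Set (Set (Site P 0))} {σ : ℕ → ℕ}
    (hD : ∀ j, D j ⊆ unionsOfCubes P (σ j)) (hσ : ∀ j, P.L ^ j ∣ σ j)
    {k : ℕ} (hk1 : 1 ≤ k) (hk : k ≤ P.m + P.K) {M₁ : ℕ} (hM₁ : 1 ≤ M₁)
    (s : B14.Eq218Concrete.Seq D k) (hsep : Sect2.SeqSeparated M₁ s)
    (T : Set (Site P 0)) (hT : ∀ j, j ≤ k → ∀ c ∈ lamBondsSeq s.Ω k j, (embIter j c.src ∈ T ↔ embIter j c.tgt ∈ T))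
    {j₁ : ℕ} (hj₁ : j₁ ≤ k) {c₁ : PBond P j₁} (hc₁ : c₁ ∈ lamBondsSeq s.Ω k j₁) (hz₁ : embIter j₁ c₁.src ∈ T)
    {j₂ : ℕ} (hj₂ : j₂ ≤ k) {c₂ : PBond P j₂} (hc₂ : c₂ ∈ lamBondsSeq s.Ω k j₂) : embIter j₂ c₂.src ∈ T :=
  towerSite_mem_of_closed_lamBondsSeq hk1 hk (fun _ h1 hj => s.chain.Ω_succ_subset_Ω h1 hj) (isBlockUnion_seq hD hσ hk s)
    (sep_of_seqSeparated hM₁ hk hsep) T hT hj₁ hc₁ hz₁ hj₂ hc₂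

variable {G : Type*} [GaugeGroup G]

/-- ★★ **THE PRINT-DATUM TOWER-CENTRAL CLAUSE BETWEEN TWO FLAT FIBRE CONFIGURATIONS, EVERY SEPARATED CUBE-CLASS INDEX**: under the letter budget `(d+3)Lᵏ ≤ |T_η|`, two holonomy-flat
configurations whose straight transporters along the bonds of `lamBondsSeq s.Ω k` are trivial are related `U^u = U₀` with `toMS u j` EQUAL and CENTRAL (`= 1`) at the two tower sites of
every print bond. [cite: Balaban1984PropagatorsII, (2.3) p.224; Balaban1985Variational, Thm 1 p.279, (3)–(4) p.278; Balaban1988Convergent, (2.2) p.255, (2.10)–(2.13) pp.256–257, (2.18) p.257] -/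
theorem exists_towerCentral_gauge_of_flat_segments_lamBondsSeq_of_seq {D : ℕ → Set (Set (Site P 0))} {σ : ℕ → ℕ}
    (hD : ∀ j, D j ⊆ unionsOfCubes P (σ j)) (hσ : ∀ j, P.L ^ j ∣ σ j)
    {k : ℕ} (hk1 : 1 ≤ k) (hk : k ≤ P.m + P.K) {M₁ : ℕ} (hM₁ : 1 ≤ M₁)
    (s : B14.Eq218Concrete.Seq D k) (hsep : Sect2.SeqSeparated M₁ s)
    (hfit : (P.d + 3) * P.L ^ k ≤ P.sitesPerDir 0) (U U₀ : GaugeField P 0 G)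
    (hflat : ∀ (x : Site P 0) (w : List (Letter P.d)), (∀ ν, netDisp w ν = 0) → holAt U (walk x w) = 1)
    (hseg : ∀ j, j ≤ k → ∀ c ∈ lamBondsSeq s.Ω k j, holAt U (walk (embIter j c.src) (List.replicate (P.L ^ j) (c.dir, true))) = 1)
    (hflat₀ : ∀ (x : Site P 0) (w : List (Letter P.d)), (∀ ν, netDisp w ν = 0) → holAt U₀ (walk x w) = 1)
    (hseg₀ : ∀ j, j ≤ k → ∀ c ∈ lamBondsSeq s.Ω k j, holAt U₀ (walk (embIter j c.src) (List.replicate (P.L ^ j) (c.dir, true))) = 1) :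
    ∃ u : GaugeTransf P 0 G, (∀ j, j ≤ k → ∀ b ∈ lamBondsSeq s.Ω k j,
        toMS u j b.src = toMS u j b.tgt ∧ ∀ g : G, toMS u j b.src * g = g * toMS u j b.src) ∧ gaugeAct u U = U₀ :=
  exists_towerCentral_gauge_of_flat_segments_lamBondsSeq hk1 hk (fun _ h1 hj => s.chain.Ω_succ_subset_Ω h1 hj) (isBlockUnion_seq hD hσ hk s)
    (sep_of_seqSeparated hM₁ hk hsep) hfit U U₀ hflat hseg hflat₀ hseg₀

end CubeClass

/-! ## §2  Every separated (2.18) index of RECORD `s : Node00.SeqOfRecord F ν M g K k` -/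

section Record

variable {F : T4Family}

/-- ★★★ **THE PRINT-DATUM TOWER-SITE GRAPH IS CONNECTED FOR EVERY SEPARATED (2.18) INDEX OF RECORD** — the indices the (E∕U) name `VariationalThm1EUSepTop7MGB … (lamDatum F) …` quantifies:
numerics `ν` with `1 ≤ ν.M₁`, cube letter `M`, history `g`, torus `K`, length `1 ≤ k ≤ m + K`, `s : SeqOfRecord F ν M g K k` (def-R's cube classes of side `LʲMR_j` ⇒ (B); r11's chain ⇒
(N)) with `Sect2.SeqSeparated ν.M₁ s` (⇒ (S)): a set `T` of fine sites closed under the bonds of `lamBondsSeq s.Ω k` (= `lamDatum F K k s.Ω`) holding ONE print tower site holds ALL of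
them — the print-datum twin of ✓p744890's `towerSite_mem_of_closed_genSet_of_seqSeparated`. [cite: Balaban1984PropagatorsII, (2.3) p.224; Balaban1988Convergent, (2.1) p.254, (2.2) p.255, (2.18) p.257; Balaban1985RegularSpaces, (1.3)–(1.6) p.77; Balaban1985Variational, Thm 1 p.279, (3)–(4) p.278] -/
theorem towerSite_mem_of_closed_lamBondsSeq_of_seqSeparated (ν : Stage7Numerics) (M : ℕ) (g : ℕ → ℝ) (K : ℕ) {k : ℕ}
    (s : SeqOfRecord F ν M g K k) (hk1 : 1 ≤ k) (hk : k ≤ (F.P K).m + (F.P K).K) (hM : 1 ≤ ν.M₁) (hsepS : Node00.Sect2.SeqSeparated ν.M₁ s)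
    (T : Set (Site (F.P K) 0)) (hT : ∀ j, j ≤ k → ∀ c ∈ lamBondsSeq s.Ω k j, (embIter j c.src ∈ T ↔ embIter j c.tgt ∈ T))
    {j₁ : ℕ} (hj₁ : j₁ ≤ k) {c₁ : PBond (F.P K) j₁} (hc₁ : c₁ ∈ lamBondsSeq s.Ω k j₁) (hz₁ : embIter j₁ c₁.src ∈ T)
    {j₂ : ℕ} (hj₂ : j₂ ≤ k) {c₂ : PBond (F.P K) j₂} (hc₂ : c₂ ∈ lamBondsSeq s.Ω k j₂) : embIter j₂ c₂.src ∈ T :=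
  towerSite_mem_of_closed_lamBondsSeq_of_seq (D := DOfRecord F ν M g K) (σ := fun j => dCubeSide (F.P K).L M (RkOfRecord (F.P K).L ν.r (g j)) j)
    (fun _ => subset_rfl) (fun j => pow_dvd_dCubeSide _ _ _ j) hk1 hk hM s hsepS T hT hj₁ hc₁ hz₁ hj₂ hc₂

/-- ★★ **THE TWIST OBSTRUCTION's PREMISE SET IS EMPTY AT PRINT's DATUM FOR EVERY SEPARATED (2.18) INDEX OF RECORD**: no set of fine sites closed under the bonds of `lamBondsSeq s.Ω k`
separates two print tower sites (`1 ≤ k ≤ m + K`, `1 ≤ ν.M₁`, `Sect2.SeqSeparated ν.M₁ s`) — dag-n12-w1's `N12Thm1CentralLetterTwistObstruction.not_T1central_flat_of_disconnected`,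
read on print's bonds, cannot be armed against the uniqueness clause of `VariationalThm1EUSepTop7MGB … (lamDatum F) …` at any index it quantifies.
[cite: Balaban1984PropagatorsII, (2.3) p.224; Balaban1988Convergent, (2.1) p.254, (2.2) p.255, (2.18) p.257; Balaban1985RegularSpaces, (1.3)–(1.6) p.77; Balaban1985Variational, Thm 1 p.279, (3)–(4) p.278] -/
theorem not_disconnected_towerSiteGraph_lamBondsSeq_of_seqSeparated (ν : Stage7Numerics) (M : ℕ) (g : ℕ → ℝ) (K : ℕ) {k : ℕ}
    (s : SeqOfRecord F ν M g K k) (hk1 : 1 ≤ k) (hk : k ≤ (F.P K).m + (F.P K).K) (hM : 1 ≤ ν.M₁) (hsepS : Node00.Sect2.SeqSeparated ν.M₁ s) :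
    ¬ ∃ (T : Set (Site (F.P K) 0)) (j₁ : ℕ) (c₁ : PBond (F.P K) j₁) (j₂ : ℕ) (c₂ : PBond (F.P K) j₂),
        (∀ j, j ≤ k → ∀ c ∈ lamBondsSeq s.Ω k j, (embIter j c.src ∈ T ↔ embIter j c.tgt ∈ T)) ∧
        j₁ ≤ k ∧ c₁ ∈ lamBondsSeq s.Ω k j₁ ∧ embIter j₁ c₁.src ∈ T ∧
        j₂ ≤ k ∧ c₂ ∈ lamBondsSeq s.Ω k j₂ ∧ embIter j₂ c₂.src ∉ T := by
  rintro ⟨T, j₁, c₁, j₂, c₂, hT, hj₁, hc₁, hz₁, hj₂, hc₂, hz₂⟩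
  exact hz₂ (towerSite_mem_of_closed_lamBondsSeq_of_seqSeparated ν M g K s hk1 hk hM hsepS T hT hj₁ hc₁ hz₁ hj₂ hc₂)

variable {G : Type*} [GaugeGroup G]

/-- ★★★ **PRINT-DATUM RIGIDITY AT THE FLAT DATUM FOR EVERY SEPARATED (2.18) INDEX OF RECORD** (budgeted length `1 ≤ k`, `k + 1 ≤ m + K`; `1 ≤ ν.M₁`; `Sect2.SeqSeparated ν.M₁ s`): a
holonomy-flat configuration `U` on the family's torus `T^{(0)}(K)` whose straight transporters along the bonds of `lamBondsSeq s.Ω k` are trivial is `1^{u}` with `u = 1` at both tower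
sites of every print bond (the letter budget `(d+3)Lᵏ ≤ |T_η|` is this seat's g17 `letterBudget_atRecord`). [cite: Balaban1984PropagatorsII, (2.3) p.224; Balaban1985Variational, Thm 1 p.279, (3)–(4) p.278; Balaban1988Convergent, (2.2) p.255, (2.10)–(2.13) pp.256–257, (2.18) p.257] -/
theorem exists_gauge_eq_one_on_towers_of_flat_segments_lamBondsSeq_of_seqSeparated (ν : Stage7Numerics) (M : ℕ) (g : ℕ → ℝ) (K : ℕ) {k : ℕ}
    (s : SeqOfRecord F ν M g K k) (hk1 : 1 ≤ k) (hkK : k + 1 ≤ (F.P K).m + (F.P K).K) (hM : 1 ≤ ν.M₁) (hsepS : Node00.Sect2.SeqSeparated ν.M₁ s)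
    (U : GaugeField (F.P K) 0 G) (hflat : ∀ (x : Site (F.P K) 0) (w : List (Letter (F.P K).d)), (∀ μ, netDisp w μ = 0) → holAt U (walk x w) = 1)
    (hseg : ∀ j, j ≤ k → ∀ c ∈ lamBondsSeq s.Ω k j, holAt U (walk (embIter j c.src) (List.replicate ((F.P K).L ^ j) (c.dir, true))) = 1) :
    ∃ u : GaugeTransf (F.P K) 0 G, (∀ j, j ≤ k → ∀ c ∈ lamBondsSeq s.Ω k j, u (embIter j c.src) = 1 ∧ u (embIter j c.tgt) = 1) ∧ gaugeAct u 1 = U :=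
  have hk : k ≤ (F.P K).m + (F.P K).K := by omega
  exists_gauge_eq_one_on_towers_of_flat_segments_lamBondsSeq hk1 hk (fun _ h1 hj => s.chain.Ω_succ_subset_Ω h1 hj)
    (isBlockUnion_seq (D := DOfRecord F ν M g K) (σ := fun j => dCubeSide (F.P K).L M (RkOfRecord (F.P K).L ν.r (g j)) j) (fun _ => subset_rfl)
      (fun j => pow_dvd_dCubeSide _ _ _ j) hk s)
    (sep_of_seqSeparated hM hk hsepS) (letterBudget_atRecord hkK) U hflat hseg

/-- ★★★ **THE PRINT-DATUM TOWER-CENTRAL CLAUSE BETWEEN TWO FLAT FIBRE CONFIGURATIONS, EVERY SEPARATED (2.18) INDEX OF RECORD** (`1 ≤ k`, `k + 1 ≤ m + K`, `1 ≤ ν.M₁`,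
`Sect2.SeqSeparated ν.M₁ s`): two holonomy-flat configurations with trivial straight transporters along the bonds of `lamBondsSeq s.Ω k` (= `lamDatum F K k s.Ω`) are related `U^u = U₀`
with `toMS u j b₋ = toMS u j b₊` CENTRAL (`= 1`) for every print bond `b` — the conclusion shape of the uniqueness clause of dag-n12-c's ✓p767125 `VariationalThm1EUSepTop7MGB … (lamDatum F) …`
at two flat minimisers; the brick its A2 witness at `W := M˙(1)` calls (the (b)-datum edition ✓p744645 :135 calls the `genSet` twin at these binders).
[cite: Balaban1984PropagatorsII, (2.3) p.224; Balaban1985Variational, Thm 1 p.279, (3)–(4) p.278; Balaban1988Convergent, (2.2) p.255, (2.10)–(2.13) pp.256–257, (2.18) p.257; Balaban1989LargeFieldII, (1.25) p.362] -/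
theorem exists_towerCentral_gauge_of_flat_segments_lamBondsSeq_of_seqSeparated (ν : Stage7Numerics) (M : ℕ) (g : ℕ → ℝ) (K : ℕ) {k : ℕ}
    (s : SeqOfRecord F ν M g K k) (hk1 : 1 ≤ k) (hkK : k + 1 ≤ (F.P K).m + (F.P K).K) (hM : 1 ≤ ν.M₁) (hsepS : Node00.Sect2.SeqSeparated ν.M₁ s)
    (U U₀ : GaugeField (F.P K) 0 G)
    (hflat : ∀ (x : Site (F.P K) 0) (w : List (Letter (F.P K).d)), (∀ μ, netDisp w μ = 0) → holAt U (walk x w) = 1)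
    (hseg : ∀ j, j ≤ k → ∀ c ∈ lamBondsSeq s.Ω k j, holAt U (walk (embIter j c.src) (List.replicate ((F.P K).L ^ j) (c.dir, true))) = 1)
    (hflat₀ : ∀ (x : Site (F.P K) 0) (w : List (Letter (F.P K).d)), (∀ μ, netDisp w μ = 0) → holAt U₀ (walk x w) = 1)
    (hseg₀ : ∀ j, j ≤ k → ∀ c ∈ lamBondsSeq s.Ω k j, holAt U₀ (walk (embIter j c.src) (List.replicate ((F.P K).L ^ j) (c.dir, true))) = 1) :
    ∃ u : GaugeTransf (F.P K) 0 G, (∀ j, j ≤ k → ∀ b ∈ lamBondsSeq s.Ω k j,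
        toMS u j b.src = toMS u j b.tgt ∧ ∀ g : G, toMS u j b.src * g = g * toMS u j b.src) ∧ gaugeAct u U = U₀ :=
  have hk : k ≤ (F.P K).m + (F.P K).K := by omega
  exists_towerCentral_gauge_of_flat_segments_lamBondsSeq_of_seq (D := DOfRecord F ν M g K) (σ := fun j => dCubeSide (F.P K).L M (RkOfRecord (F.P K).L ν.r (g j)) j)
    (fun _ => subset_rfl) (fun j => pow_dvd_dCubeSide _ _ _ j) hk1 hk hM s hsepS (letterBudget_atRecord hkK) U U₀ hflat hseg hflat₀ hseg₀

end Record

/-! ## §3  The torus class of the letters: `D n = unionsOfCubes (side L M₁ n)` -/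

section TorusClass

variable {F : T4Family} {G : Type*} [GaugeGroup G]

/-- ★★ **THE PRINT-DATUM TOWER-CENTRAL CLAUSE FOR EVERY SEPARATED INDEX OF THE TORUS CLASS** (`s : Seq (unionsOfCubes (side L M₁ n)) k` on the family's torus `T(Kt)`, `0 < M₁`, `1 ≤ k`,
`k + 1 ≤ m + K`, separated): two holonomy-flat configurations with trivial straight transporters along the bonds of `lamBondsSeq s.Ω k` are tower-centrally gauge related on print's
bonds — the index class of the lane's torus-class letters (✓p744645 §3 `thm1TorusClassEU_body_at_flatDatum`'s indices). [cite: Balaban1984PropagatorsII, (2.3) p.224; Balaban1985Variational, Thm 1 p.279, (3)–(4) p.278; Balaban1988Convergent, (2.2) p.255, (2.13) pp.256–257, (2.18) p.257] -/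
theorem exists_towerCentral_gauge_of_flat_segments_lamBondsSeq_torusClass (Kt : ℕ) {M₁ : ℕ} (hM : 0 < M₁) {k : ℕ} (hk1 : 1 ≤ k)
    (hkK : k + 1 ≤ (F.P Kt).m + (F.P Kt).K)
    (s : B14.Eq218Concrete.Seq (fun n : ℕ => unionsOfCubes (F.P Kt) (side (F.P Kt).L M₁ n)) k) (hsep : Sect2.SeqSeparated M₁ s)
    (U U₀ : GaugeField (F.P Kt) 0 G)
    (hflat : ∀ (x : Site (F.P Kt) 0) (w : List (Letter (F.P Kt).d)), (∀ μ, netDisp w μ = 0) → holAt U (walk x w) = 1)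
    (hseg : ∀ j, j ≤ k → ∀ c ∈ lamBondsSeq s.Ω k j, holAt U (walk (embIter j c.src) (List.replicate ((F.P Kt).L ^ j) (c.dir, true))) = 1)
    (hflat₀ : ∀ (x : Site (F.P Kt) 0) (w : List (Letter (F.P Kt).d)), (∀ μ, netDisp w μ = 0) → holAt U₀ (walk x w) = 1)
    (hseg₀ : ∀ j, j ≤ k → ∀ c ∈ lamBondsSeq s.Ω k j, holAt U₀ (walk (embIter j c.src) (List.replicate ((F.P Kt).L ^ j) (c.dir, true))) = 1) :
    ∃ u : GaugeTransf (F.P Kt) 0 G, (∀ j, j ≤ k → ∀ b ∈ lamBondsSeq s.Ω k j,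
        toMS u j b.src = toMS u j b.tgt ∧ ∀ g : G, toMS u j b.src * g = g * toMS u j b.src) ∧ gaugeAct u U = U₀ :=
  have hk : k ≤ (F.P Kt).m + (F.P Kt).K := by omega
  exists_towerCentral_gauge_of_flat_segments_lamBondsSeq_of_seq (D := fun n : ℕ => unionsOfCubes (F.P Kt) (side (F.P Kt).L M₁ n))
    (σ := fun n => side (F.P Kt).L M₁ n) (fun _ => subset_rfl) (fun j => pow_dvd_side _ _ j) hk1 hk hM s hsep (letterBudget_atRecord hkK) U U₀ hflat hseg hflat₀ hseg₀

end TorusClass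

end Summit.QuantumFields.YangMills.BalabanUVNodes.N12FlatDatumRigidityNestedLamOfRecord
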